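import Summits.RiemannHypothesis.RiemannHypothesis.Theorems.SignConeSignConeDualityStubMultipliers
import Summits.RiemannHypothesis.RiemannHypothesis.Theorems.SignConeSignConeDualityStubEngine
import Summits.RiemannHypothesis.RiemannHypothesis.Theorems.SignConeSignConeDualityStubSlater
import Summits.RiemannHypothesis.RiemannHypothesis.Theorems.SignConeSignConeDualityStubFarNode
import Summits.RiemannHypothesis.RiemannHypothesis.Theorems.SignConeSignConeDualityStubArchPolarAdd
import Summits.RiemannHypothesis.RiemannHypothesis.Theorems.SignConeSignConeDualityStubScaling

/-!
# Stub `stub_extremalExists` (line `dual_witness`, crux `SignConeOscillatory`, stmt-RiemannHypothesis-16302), III: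
# node multipliers with a general slack parameter

The cone-multiplier engine of the proved crux `SignConeDuality` (`SignConeDuality.stub_engine`, fed by
`stub_slater`, `stub_farNode`, `stub_archPolarAdd`, `stub_scaling`) instantiated on the image of the Weil cone
`P(a)` under the SHIFTED moment map `F ↦ (Re W_ar(F) + θ·Re F(0), (Re F(log n))_{2 ≤ n < ⌈e^{2a}⌉})`:
if `Re W_ar(F) + θ·Re F(0) ≥ 0` on node-nonnegative autocorrelation sums `F = Σᵢ gᵢ ⋆ g̃ᵢ` at cutoff `a`, then
there are multipliers `l ≥ 0` with `Σ_{2 ≤ n < ⌈e^{2a}⌉} lₙ Re G(log n) ≤ Re W_ar(G) + θ·Re G(0)` for every Weil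
test `g` supported in `[-a, a]`, `G = g ⋆ g̃` (`shifted_multipliers`).  For `θ = 1` this is literally
`SignConeDuality.stub_multipliers` with its five hypotheses discharged; the proof below is that proof verbatim
(prover of stmt-RiemannHypothesis-16304, file `SignConeSignConeDualityStubMultipliers.lean`) with the objective
`L₀ F = Re W_ar(F) + Re F(0)` replaced by `L_θ F = Re W_ar(F) + θ Re F(0)`.  Used with `θ = 1 − m(a)`, `m(a)` the
sign-cone value, to produce the dual-feasible fake primes of the KKT certificate.
-/

noncomputable section

-- `Summit.RiemannHypothesis.RiemannHypothesis.…` repeats a namespace component by design (D-0017 layout).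
set_option linter.dupNamespace false

open scoped BigOperators ComplexConjugate
open Complex MeasureTheory Set

namespace Summit.RiemannHypothesis.RiemannHypothesis.Theorems.SignCone.DualWitness

open Literature.NumberTheory.LFunctions
open Summit.RiemannHypothesis.RiemannHypothesis.Theorems.SignConeDuality

/-- **Node multipliers with slack parameter `θ`.**  If `Re W_ar(F) + θ Re F(0) ≥ 0` for every node-nonnegative
autocorrelation sum `F = Σᵢ gᵢ ⋆ g̃ᵢ` of Weil tests supported in `[-a, a]`, then there are `l ≥ 0` with
`Σ_{2 ≤ n < ⌈e^{2a}⌉} lₙ Re G(log n) ≤ Re W_ar(G) + θ Re G(0)` for every Weil test `g` supported in `[-a, a]`,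
`G = g ⋆ g̃`.  (The engine `SignConeDuality.stub_engine` on the shifted image cone; `θ = 1` is
`SignConeDuality.stub_multipliers`.) [folklore] -/
theorem shifted_multipliers : ∀ (a θ : ℝ), 0 < a → (∀ (k : ℕ) (g : Fin k → ℝ → ℂ), (∀ i, IsWeilTest (g i) ∧ tsupport (g i) ⊆ Set.Icc (-a) a) → (∀ n : ℕ, 2 ≤ n → 0 ≤ (∑ i, weilConv (g i) (weilReflect (g i)) (Real.log n)).re) → 0 ≤ (weilPolarTerm (fun t => ∑ i, weilConv (g i) (weilReflect (g i)) t) + weilArchTerm (fun t => ∑ i, weilConv (g i) (weilReflect (g i)) t)).re + θ * (∑ i, weilConv (g i) (weilReflect (g i)) 0).re) → ∃ l : ℕ → ℝ, (∀ n, 0 ≤ l n) ∧ ∀ g : ℝ → ℂ, IsWeilTest g → tsupport g ⊆ Set.Icc (-a) a → ∑ n ∈ Finset.Ico 2 ⌈Real.exp (2 * a)⌉₊, l n * (weilConv g (weilReflect g) (Real.log n)).re ≤ (weilPolarTerm (weilConv g (weilReflect g)) + weilArchTerm (weilConv g (weilReflect g))).re + θ * (weilConv g (weilReflect g) 0).re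 := by
  intro a θ ha hX
  classical
  -- verbatim from `SignConeDuality.stub_multipliers` with `L₀ ↦ L_θ`
  set N : ℕ := ⌈Real.exp (2 * a)⌉₊ with hN
  let adm : (ℝ → ℂ) → Prop := fun g => IsWeilTest g ∧ tsupport g ⊆ Set.Icc (-a) a
  let K : Set (ℝ → ℂ) :=
    {F | ∃ (k : ℕ) (g : Fin k → ℝ → ℂ), (∀ i, adm (g i)) ∧
      F = fun t => ∑ i, weilConv (g i) (weilReflect (g i)) t}
  let L₀ : (ℝ → ℂ) → ℝ := fun F => (weilPolarTerm F + weilArchTerm F).re + θ * (F 0).re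
  let m : (ℝ → ℂ) → ℝ × ({n // n ∈ Finset.Ico 2 N} → ℝ) :=
    fun F => (L₀ F, fun n => (F (Real.log (n : ℕ))).re)
  let S : Set (ℝ × ({n // n ∈ Finset.Ico 2 N} → ℝ)) := m '' K
  have hKtest : ∀ F ∈ K, IsWeilTest F := by
    rintro F ⟨k, g, hg, rfl⟩
    exact isWeilTest_fun_sum _ (fun i => isWeilTest_autocorr (hg i).1)
  have hKadd : ∀ F ∈ K, ∀ F' ∈ K, F + F' ∈ K := by
    rintro F ⟨k, g, hg, rfl⟩ F' ⟨k', g', hg', rfl⟩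
    refine ⟨k + k', Fin.append g g', fun i => ?_, ?_⟩
    · refine Fin.addCases (fun i => ?_) (fun i => ?_) i
      · rw [Fin.append_left]
        exact hg i
      · rw [Fin.append_right]
        exact hg' i
    · funext t
      simp only [Pi.add_apply]
      exact (autocorrSum_append g g' t).symm
  have hKsmul : ∀ r : ℝ, 0 < r → ∀ F ∈ K, (fun t => (r : ℂ) * F t) ∈ K := by
    rintro r hr F ⟨k, g, hg, rfl⟩
    refine ⟨k, fun i s => (Real.sqrt r : ℂ) * g i s, fun i => admissible_const_mul _ (hg i), ?_⟩
    funext t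
    exact (autocorrSum_sqrt_mul g hr.le t).symm
  have h₀add : ∀ F ∈ K, ∀ F' ∈ K, L₀ (F + F') = L₀ F + L₀ F' := by
    intro F hF F' hF'
    simp only [L₀]
    rw [stub_archPolarAdd F F' (hKtest F hF) (hKtest F' hF')]
    simp only [Pi.add_apply, Complex.add_re]
    ring
  have h₀smul : ∀ (r : ℝ) (F : ℝ → ℂ), L₀ (fun t => (r : ℂ) * F t) = r * L₀ F := by
    intro r F
    simp only [L₀]
    rw [stub_scaling (r : ℂ) F]
    simp only [Complex.re_ofReal_mul]
    ring
  have hSadd : ∀ x ∈ S, ∀ y ∈ S, x + y ∈ S := by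
    rintro x ⟨F, hF, rfl⟩ y ⟨F', hF', rfl⟩
    refine ⟨F + F', hKadd F hF F' hF', ?_⟩
    refine Prod.ext ?_ (funext fun n => ?_)
    · simp only [m, Prod.fst_add]
      exact h₀add F hF F' hF'
    · simp only [m, Prod.snd_add, Pi.add_apply, Complex.add_re]
  have hSsmul : ∀ r : ℝ, 0 < r → ∀ x ∈ S, r • x ∈ S := by
    rintro r hr x ⟨F, hF, rfl⟩
    refine ⟨fun t => (r : ℂ) * F t, hKsmul r hr F hF, ?_⟩
    refine Prod.ext ?_ (funext fun n => ?_)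
    · simp only [m, Prod.smul_fst, smul_eq_mul]
      exact h₀smul r F
    · simp only [m, Prod.smul_snd, Pi.smul_apply, smul_eq_mul, Complex.re_ofReal_mul]
  have hSpos : ∀ x ∈ S, (∀ i, 0 ≤ x.2 i) → 0 ≤ x.1 := by
    rintro x ⟨F, ⟨k, g, hg, rfl⟩, rfl⟩ hnodes
    have hall : ∀ n : ℕ, 2 ≤ n →
        0 ≤ (∑ i, weilConv (g i) (weilReflect (g i)) (Real.log n)).re := by
      intro n hn
      by_cases hlt : n < N
      · have h := hnodes ⟨n, Finset.mem_Ico.2 ⟨hn, hlt⟩⟩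
        simpa [m] using h
      · push Not at hlt
        have hlog : 2 * a ≤ Real.log n := two_mul_le_log_of_ceil_le (by omega) hlt
        rw [Finset.sum_eq_zero fun i _ => stub_farNode a (g i) (hg i).1 (hg i).2 _ hlog]
        simp
    have h := hX k g hg hall
    simp only [m, L₀]
    exact h
  have hSsl : ∃ x ∈ S, ∀ i, 0 < x.2 i := by
    obtain ⟨g₀, hg₀, hg₀supp, hg₀pos⟩ := stub_slater a ha
    refine ⟨m (fun t => ∑ i : Fin 1, weilConv g₀ (weilReflect g₀) t),
      ⟨_, ⟨1, fun _ => g₀, fun _ => ⟨hg₀, hg₀supp⟩, rfl⟩, rfl⟩, ?_⟩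
    rintro ⟨n, hn⟩
    obtain ⟨hn2, hnN⟩ := Finset.mem_Ico.1 hn
    simp only [m, Fin.sum_univ_one]
    exact hg₀pos n hn2 (log_lt_two_mul_of_lt_ceil (by omega) hnN)
  obtain ⟨l, hl0, hl⟩ := stub_engine _ S hSadd hSsmul hSpos hSsl
  refine ⟨fun n => if h : n ∈ Finset.Ico 2 N then l ⟨n, h⟩ else 0, fun n => ?_, ?_⟩
  · by_cases h : n ∈ Finset.Ico 2 N
    · simp only [h, dif_pos]
      exact hl0 _
    · simp [h]
  · intro g hg hsupp
    have hGK : (fun t => ∑ i : Fin 1, weilConv g (weilReflect g) t) ∈ K :=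
      ⟨1, fun _ => g, fun _ => ⟨hg, hsupp⟩, rfl⟩
    have hmain := hl _ ⟨_, hGK, rfl⟩
    have hG1 : (fun t => ∑ i : Fin 1, weilConv g (weilReflect g) t) = weilConv g (weilReflect g) := by
      funext t
      simp
    rw [hG1] at hmain
    simp only [m, L₀] at hmain
    have hsum : ∑ n ∈ Finset.Ico 2 N, (if h : n ∈ Finset.Ico 2 N then l ⟨n, h⟩ else 0) *
          (weilConv g (weilReflect g) (Real.log n)).re =
        ∑ i : {n // n ∈ Finset.Ico 2 N}, l i * (weilConv g (weilReflect g) (Real.log (i : ℕ))).re := by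
      rw [← Finset.sum_coe_sort (Finset.Ico 2 N)]
      refine Finset.sum_congr rfl fun i _ => ?_
      rw [dif_pos i.2]
    rw [hsum]
    exact hmain

end Summit.RiemannHypothesis.RiemannHypothesis.Theorems.SignCone.DualWitness

end
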